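import Summits.Ventures.DiscreteObjects.PP12.FanoFiveFinite
import Summits.Ventures.DiscreteObjects.PP12.FanoFiveIncMatrix

/-!
# PP(12), order 5: designs g10's SIGN/GRAM engine system as a typed statement, and the signs read off a typed orbit matrix (kernel)
Framing: lottery ticket; floor = certified bounds/negative ranges.

Cell pub-namedobj (venture DiscreteObjects), target (M), designs gen 17 (designs g16 HANDOFF item (c): the p = 5 IDENTIFICATION).
The census verdict for the order-5 cell of PP(12) was computed by designs g10 (two engines, hub-local, exact; FAMILY-P5PLANE §3/§5) on the
system of UNKNOWNS `m ∈ {±1}` on the `28` antiflags of the fixed Fano subplane (`0` on flags), `E, E* ∈ {±1}^{16×7}`, `R ∈ {0,1,2}^{16×16}` with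
CONSTRAINTS: columns of `E`, `E*` balanced; every row and every column of `R` has exactly two entries `2` and two entries `1`;
`EᵀE = 24I − 2MMᵀ`, `E*ᵀE* = 24I − 2MᵀM`, `2RRᵀ + EEᵀ = 24I + 3J`, `2RᵀR + E*E*ᵀ = 24I + 3J`, `RE* = −EM`, `RᵀE = −E*Mᵀ`; rows of `E`
(of `E*`) pairwise distinct. `FanoFive.IsSignSystem I m E Es R` types exactly this system for a labelled Fano incidence `I` (flags `I x μ = true`).
From a typed orbit matrix `M : F5Idx → F5Idx → ℕ` (`IsFanoFiveIncMatrix I M`, designs g15) the signs are READ OFF as differences of the two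
entries of a tangent pair: `sgnM M x μ = M (x,0)(μ,0) − M (x,0)(μ,1)` (`+1` iff the line orbit `(x,0)` meets `μ` in the point orbit `(μ,0)`),
`eps M O x = M (x,0) O − M (x,1) O` (`+1` iff the exterior point orbit `O` is attached to `(x,0)`), `epsStar M N μ = M N (μ,0) − M N (μ,1)`,
`rr M O N = M N O`. This file: the statement, the read-off maps, and the local facts (the `2 × 2` tangent blocks are `t·(permutation matrix)`,
ranges `0 / ±1`, `{0,1,2}`, and the pair identity `2 Σ_a M (x,a) O · M (x,a) O' = 1 + ε_x(O) ε_x(O')`). The Gram identities and the reduction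
`IsFanoFiveIncMatrix I M → IsSignSystem I …` follow in `FanoFiveSignGram` / `FanoFiveSignPairs` / `FanoFiveSignReduction`.
Nothing here asserts any census statement; designs g10's EMPTY verdict stays a computation outside the kernel. No `sorry`, no new axioms.
-/

namespace Summit.Ventures.DiscreteObjects.PP12

open Finset

namespace FanoFive

/-- **designs g10's engine system (FAMILY-P5PLANE §3) for the labelled Fano incidence `I`** — unknowns `m` (tangent matchings, `7 × 7`,
`0` on flags, `±1` on antiflags), `E` / `Es` (`= E*`; `16 × 7`, `±1`), `R` (`16 × 16`, entries `0,1,2`), all over `ℤ`; constraints: balance,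
the `{2,2,1,1}` profile of every row and column of `R`, the four Gram identities, the two mixed identities, distinct rows. -/
structure IsSignSystem (I : Fin 7 → Fin 7 → Bool) (m : Fin 7 → Fin 7 → ℤ) (E Es : Fin 16 → Fin 7 → ℤ) (R : Fin 16 → Fin 16 → ℤ) : Prop where
  /-- `m` vanishes on flags -/
  m_flag : ∀ x μ, I x μ = true → m x μ = 0
  /-- `m` is a sign on antiflags -/
  m_antiflag : ∀ x μ, I x μ = false → m x μ = 1 ∨ m x μ = -1
  /-- `E` is a sign matrix -/
  E_sign : ∀ O x, E O x = 1 ∨ E O x = -1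
  /-- `E*` is a sign matrix -/
  Es_sign : ∀ N μ, Es N μ = 1 ∨ Es N μ = -1
  /-- `R` has entries `0, 1, 2` -/
  R_range : ∀ O N, R O N = 0 ∨ R O N = 1 ∨ R O N = 2
  /-- columns of `E` are balanced -/
  E_balanced : ∀ x, ∑ O, E O x = 0
  /-- columns of `E*` are balanced -/
  Es_balanced : ∀ μ, ∑ N, Es N μ = 0
  /-- every row of `R` has exactly two entries `2` and two entries `1` -/
  R_row_profile : ∀ O, (univ.filter fun N => R O N = 2).card = 2 ∧ (univ.filter fun N => R O N = 1).card = 2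
  /-- every column of `R` has exactly two entries `2` and two entries `1` -/
  R_col_profile : ∀ N, (univ.filter fun O => R O N = 2).card = 2 ∧ (univ.filter fun O => R O N = 1).card = 2
  /-- `EᵀE = 24 I − 2 M Mᵀ` -/
  gram_E : ∀ x y, ∑ O, E O x * E O y = (if x = y then 24 else 0) - 2 * ∑ μ, m x μ * m y μ
  /-- `E*ᵀE* = 24 I − 2 Mᵀ M` -/
  gram_Es : ∀ μ ν, ∑ N, Es N μ * Es N ν = (if μ = ν then 24 else 0) - 2 * ∑ x, m x μ * m x ν
  /-- `2 R Rᵀ + E Eᵀ = 24 I + 3 J` -/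
  gram_R_rows : ∀ O O', 2 * ∑ N, R O N * R O' N + ∑ x, E O x * E O' x = if O = O' then 27 else 3
  /-- `2 Rᵀ R + E* E*ᵀ = 24 I + 3 J` -/
  gram_R_cols : ∀ N N', 2 * ∑ O, R O N * R O N' + ∑ μ, Es N μ * Es N' μ = if N = N' then 27 else 3
  /-- `R E* = − E M` -/
  mixed_rows : ∀ O μ, ∑ N, R O N * Es N μ = -∑ x, E O x * m x μ
  /-- `Rᵀ E = − E* Mᵀ` -/
  mixed_cols : ∀ N x, ∑ O, R O N * E O x = -∑ μ, Es N μ * m x μ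
  /-- rows of `E` are pairwise distinct -/
  E_rows_ne : ∀ O O', O ≠ O' → E O ≠ E O'
  /-- rows of `E*` are pairwise distinct -/
  Es_rows_ne : ∀ N N', N ≠ N' → Es N ≠ Es N'

/-- **Census statement at the level of designs g10's engines (typed; decided EMPTY outside the kernel by designs g10, two engines):**
the sign/Gram system for the labelled Fano incidence `I` has no solution. -/
def NoSignSystem (I : Fin 7 → Fin 7 → Bool) : Prop :=
  ∀ (m : Fin 7 → Fin 7 → ℤ) (E Es : Fin 16 → Fin 7 → ℤ) (R : Fin 16 → Fin 16 → ℤ), ¬ IsSignSystem I m E Es R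

/-- tangent matching sign read off an orbit matrix: `+1` iff the line orbit `(x,0)` meets the fixed line `μ` in the point orbit `(μ,0)`,
`−1` iff in `(μ,1)`, `0` if `x ∈ μ` -/
def sgnM (M : F5Idx → F5Idx → ℕ) (x μ : Fin 7) : ℤ :=
  (M (Sum.inl (x, 0)) (Sum.inl (μ, 0)) : ℤ) - (M (Sum.inl (x, 0)) (Sum.inl (μ, 1)) : ℤ)

/-- attachment sign of an exterior point orbit `O` at the fixed point `x`: `+1` iff `O` is attached to the line orbit `(x,0)` -/
def eps (M : F5Idx → F5Idx → ℕ) (O : Fin 16) (x : Fin 7) : ℤ :=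
  (M (Sum.inl (x, 0)) (Sum.inr O) : ℤ) - (M (Sum.inl (x, 1)) (Sum.inr O) : ℤ)

/-- attachment sign of an exterior line orbit `N` at the fixed line `μ`: `+1` iff the lines of `N` meet `μ` in the point orbit `(μ,0)` -/
def epsStar (M : F5Idx → F5Idx → ℕ) (N : Fin 16) (μ : Fin 7) : ℤ :=
  (M (Sum.inr N) (Sum.inl (μ, 0)) : ℤ) - (M (Sum.inr N) (Sum.inl (μ, 1)) : ℤ)

/-- the exterior block, point orbits as rows: `rr M O N` = number of points of `O` on a line of `N` -/
def rr (M : F5Idx → F5Idx → ℕ) (O N : Fin 16) : ℤ := (M (Sum.inr N) (Sum.inr O) : ℤ)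

end FanoFive

namespace IsFanoFiveIncMatrix

open FanoFive

variable {I : Fin 7 → Fin 7 → Bool} {M : F5Idx → F5Idx → ℕ}

/-- **The `2 × 2` tangent block at `(x, μ)` is `t` times a permutation matrix** (`t = [x ∉ μ]`): anti-diagonal entries agree and diagonal
entries agree (row sums = column sums = `t`). -/
theorem block_rel (h : IsFanoFiveIncMatrix I M) (x μ : Fin 7) :
    M (Sum.inl (x, 0)) (Sum.inl (μ, 1)) = M (Sum.inl (x, 1)) (Sum.inl (μ, 0)) ∧
      M (Sum.inl (x, 1)) (Sum.inl (μ, 1)) = M (Sum.inl (x, 0)) (Sum.inl (μ, 0)) := by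
  have r0 := h.2.1 x 0 μ
  have r1 := h.2.1 x 1 μ
  have c0 := h.2.2.2.1 μ 0 x
  have c1 := h.2.2.2.1 μ 1 x
  rw [Fin.sum_univ_two] at r0 r1 c0 c1
  split_ifs at r0 r1 c0 c1 <;> omega

/-- row difference in a tangent column: `M (x,0) (μ,0) − M (x,1) (μ,0) = sgnM M x μ` -/
theorem rowdiff_zero (h : IsFanoFiveIncMatrix I M) (x μ : Fin 7) :
    (M (Sum.inl (x, 0)) (Sum.inl (μ, 0)) : ℤ) - (M (Sum.inl (x, 1)) (Sum.inl (μ, 0)) : ℤ) = sgnM M x μ := by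
  have hb := block_rel h x μ
  unfold sgnM; omega

/-- row difference in a tangent column: `M (x,0) (μ,1) − M (x,1) (μ,1) = − sgnM M x μ` -/
theorem rowdiff_one (h : IsFanoFiveIncMatrix I M) (x μ : Fin 7) :
    (M (Sum.inl (x, 0)) (Sum.inl (μ, 1)) : ℤ) - (M (Sum.inl (x, 1)) (Sum.inl (μ, 1)) : ℤ) = -sgnM M x μ := by
  have hb := block_rel h x μ
  unfold sgnM; omega

/-- column difference in a tangent row: `M (x,0) (μ,0) − M (x,0) (μ,1) = sgnM M x μ` (the definition) -/
theorem coldiff_zero (M : F5Idx → F5Idx → ℕ) (x μ : Fin 7) :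
    (M (Sum.inl (x, 0)) (Sum.inl (μ, 0)) : ℤ) - (M (Sum.inl (x, 0)) (Sum.inl (μ, 1)) : ℤ) = sgnM M x μ := rfl

/-- column difference in a tangent row: `M (x,1) (μ,0) − M (x,1) (μ,1) = − sgnM M x μ` -/
theorem coldiff_one (h : IsFanoFiveIncMatrix I M) (x μ : Fin 7) :
    (M (Sum.inl (x, 1)) (Sum.inl (μ, 0)) : ℤ) - (M (Sum.inl (x, 1)) (Sum.inl (μ, 1)) : ℤ) = -sgnM M x μ := by
  have hb := block_rel h x μ
  unfold sgnM; omega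

/-- `sgnM` vanishes on flags -/
theorem sgnM_flag (h : IsFanoFiveIncMatrix I M) {x μ : Fin 7} (hx : I x μ = true) : sgnM M x μ = 0 := by
  have r0 := h.2.1 x 0 μ
  rw [Fin.sum_univ_two, if_pos hx] at r0
  unfold sgnM; omega

/-- `sgnM` is a sign on antiflags -/
theorem sgnM_antiflag (h : IsFanoFiveIncMatrix I M) {x μ : Fin 7} (hx : I x μ = false) : sgnM M x μ = 1 ∨ sgnM M x μ = -1 := by
  have r0 := h.2.1 x 0 μ
  rw [Fin.sum_univ_two, if_neg (by simp [hx])] at r0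
  unfold sgnM; omega

/-- `sgnM M x μ = 0 ↔ x ∈ μ` -/
theorem sgnM_eq_zero_iff (h : IsFanoFiveIncMatrix I M) (x μ : Fin 7) : sgnM M x μ = 0 ↔ I x μ = true := by
  constructor
  · intro h0
    by_contra hx
    rcases sgnM_antiflag h (Bool.eq_false_iff.mpr hx) with h1 | h1 <;> omega
  · exact sgnM_flag h

/-- the square of `sgnM` is the antiflag indicator -/
theorem sgnM_sq (h : IsFanoFiveIncMatrix I M) (x μ : Fin 7) : sgnM M x μ * sgnM M x μ = if I x μ then 0 else 1 := by
  by_cases hx : I x μ = true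
  · rw [if_pos hx, sgnM_flag h hx]; ring
  · rw [if_neg hx]
    rcases sgnM_antiflag h (Bool.eq_false_iff.mpr hx) with h1 | h1 <;> rw [h1] <;> ring

/-- the two attachment entries of an exterior point orbit at a fixed point sum to `1` -/
theorem att_sum (h : IsFanoFiveIncMatrix I M) (O : Fin 16) (x : Fin 7) :
    M (Sum.inl (x, 0)) (Sum.inr O) + M (Sum.inl (x, 1)) (Sum.inr O) = 1 := by
  have := h.2.2.2.2 O x
  rwa [Fin.sum_univ_two] at this

/-- `eps` is a sign -/
theorem eps_sign (h : IsFanoFiveIncMatrix I M) (O : Fin 16) (x : Fin 7) : eps M O x = 1 ∨ eps M O x = -1 := by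
  have := att_sum h O x
  unfold eps; omega

/-- the two entries of an exterior line orbit on a fixed line sum to `1` -/
theorem attStar_sum (h : IsFanoFiveIncMatrix I M) (N : Fin 16) (μ : Fin 7) :
    M (Sum.inr N) (Sum.inl (μ, 0)) + M (Sum.inr N) (Sum.inl (μ, 1)) = 1 := by
  have := h.2.2.1 N μ
  rwa [Fin.sum_univ_two] at this

/-- `epsStar` is a sign -/
theorem epsStar_sign (h : IsFanoFiveIncMatrix I M) (N : Fin 16) (μ : Fin 7) : epsStar M N μ = 1 ∨ epsStar M N μ = -1 := by
  have := attStar_sum h N μ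
  unfold epsStar; omega

/-- `rr` has entries `0, 1, 2` -/
theorem rr_range (h : IsFanoFiveIncMatrix I M) (O N : Fin 16) : rr M O N = 0 ∨ rr M O N = 1 ∨ rr M O N = 2 := by
  have := IsFanoFiveOrbitMatrix.entry_le_two h.1 (Sum.inr N) (Sum.inr O)
  unfold rr; omega

/-- `rr` is non-negative -/
theorem rr_nonneg (M : F5Idx → F5Idx → ℕ) (O N : Fin 16) : 0 ≤ rr M O N := by
  unfold rr; positivity

/-- **pair identity in the tangent rows:** `2 Σ_a M (x,a) O · M (x,a) O' = 1 + ε_x(O) ε_x(O')` -/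
theorem two_mul_att_prod (h : IsFanoFiveIncMatrix I M) (x : Fin 7) (O O' : Fin 16) :
    2 * ∑ a : Fin 2, (M (Sum.inl (x, a)) (Sum.inr O) : ℤ) * (M (Sum.inl (x, a)) (Sum.inr O') : ℤ) = 1 + eps M O x * eps M O' x := by
  have hu := att_sum h O x
  have hv := att_sum h O' x
  rw [Fin.sum_univ_two]
  unfold eps
  have hu' : (M (Sum.inl (x, 0)) (Sum.inr O) : ℤ) + (M (Sum.inl (x, 1)) (Sum.inr O) : ℤ) = 1 := by exact_mod_cast hu
  have hv' : (M (Sum.inl (x, 0)) (Sum.inr O') : ℤ) + (M (Sum.inl (x, 1)) (Sum.inr O') : ℤ) = 1 := by exact_mod_cast hv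
  linear_combination ((M (Sum.inl (x, 0)) (Sum.inr O') : ℤ) + (M (Sum.inl (x, 1)) (Sum.inr O') : ℤ)) * hu' + hv'

/-- **pair identity in the tangent columns:** `2 Σ_b M N (μ,b) · M N' (μ,b) = 1 + ε*_μ(N) ε*_μ(N')` -/
theorem two_mul_attStar_prod (h : IsFanoFiveIncMatrix I M) (μ : Fin 7) (N N' : Fin 16) :
    2 * ∑ b : Fin 2, (M (Sum.inr N) (Sum.inl (μ, b)) : ℤ) * (M (Sum.inr N') (Sum.inl (μ, b)) : ℤ) =
      1 + epsStar M N μ * epsStar M N' μ := by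
  have hu := attStar_sum h N μ
  have hv := attStar_sum h N' μ
  rw [Fin.sum_univ_two]
  unfold epsStar
  have hu' : (M (Sum.inr N) (Sum.inl (μ, 0)) : ℤ) + (M (Sum.inr N) (Sum.inl (μ, 1)) : ℤ) = 1 := by exact_mod_cast hu
  have hv' : (M (Sum.inr N') (Sum.inl (μ, 0)) : ℤ) + (M (Sum.inr N') (Sum.inl (μ, 1)) : ℤ) = 1 := by exact_mod_cast hv
  linear_combination ((M (Sum.inr N') (Sum.inl (μ, 0)) : ℤ) + (M (Sum.inr N') (Sum.inl (μ, 1)) : ℤ)) * hu' + hv'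

/-- an attachment entry times the sign: `Σ_a (M (x,a) (μ,0) − M (x,a) (μ,1)) · M (x,a) O = sgnM M x μ · eps M O x` -/
theorem sum_coldiff_mul_att (h : IsFanoFiveIncMatrix I M) (x μ : Fin 7) (O : Fin 16) :
    ∑ a : Fin 2, ((M (Sum.inl (x, a)) (Sum.inl (μ, 0)) : ℤ) - (M (Sum.inl (x, a)) (Sum.inl (μ, 1)) : ℤ)) *
        (M (Sum.inl (x, a)) (Sum.inr O) : ℤ) = sgnM M x μ * eps M O x := by
  rw [Fin.sum_univ_two, coldiff_zero M x μ, coldiff_one h x μ]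
  unfold eps; ring

/-- a tangent-column entry times the sign: `Σ_b (M (x,0) (μ,b) − M (x,1) (μ,b)) · M N (μ,b) = sgnM M x μ · epsStar M N μ` -/
theorem sum_rowdiff_mul_attStar (h : IsFanoFiveIncMatrix I M) (x μ : Fin 7) (N : Fin 16) :
    ∑ b : Fin 2, ((M (Sum.inl (x, 0)) (Sum.inl (μ, b)) : ℤ) - (M (Sum.inl (x, 1)) (Sum.inl (μ, b)) : ℤ)) *
        (M (Sum.inr N) (Sum.inl (μ, b)) : ℤ) = sgnM M x μ * epsStar M N μ := by
  rw [Fin.sum_univ_two, rowdiff_zero h x μ, rowdiff_one h x μ]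
  unfold epsStar; ring

/-- product of row differences in a tangent column: `Σ_b (M (x,0)(μ,b) − M (x,1)(μ,b)) (M (y,0)(μ,b) − M (y,1)(μ,b)) = 2 sgnM x μ · sgnM y μ` -/
theorem sum_rowdiff_mul_rowdiff (h : IsFanoFiveIncMatrix I M) (x y μ : Fin 7) :
    ∑ b : Fin 2, ((M (Sum.inl (x, 0)) (Sum.inl (μ, b)) : ℤ) - (M (Sum.inl (x, 1)) (Sum.inl (μ, b)) : ℤ)) *
        ((M (Sum.inl (y, 0)) (Sum.inl (μ, b)) : ℤ) - (M (Sum.inl (y, 1)) (Sum.inl (μ, b)) : ℤ)) = 2 * (sgnM M x μ * sgnM M y μ) := by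
  rw [Fin.sum_univ_two, rowdiff_zero h x μ, rowdiff_one h x μ, rowdiff_zero h y μ, rowdiff_one h y μ]
  ring

/-- product of column differences in a tangent row: `Σ_a (M (x,a)(μ,0) − M (x,a)(μ,1)) (M (x,a)(ν,0) − M (x,a)(ν,1)) = 2 sgnM x μ · sgnM x ν` -/
theorem sum_coldiff_mul_coldiff (h : IsFanoFiveIncMatrix I M) (x μ ν : Fin 7) :
    ∑ a : Fin 2, ((M (Sum.inl (x, a)) (Sum.inl (μ, 0)) : ℤ) - (M (Sum.inl (x, a)) (Sum.inl (μ, 1)) : ℤ)) *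
        ((M (Sum.inl (x, a)) (Sum.inl (ν, 0)) : ℤ) - (M (Sum.inl (x, a)) (Sum.inl (ν, 1)) : ℤ)) = 2 * (sgnM M x μ * sgnM M x ν) := by
  rw [Fin.sum_univ_two, coldiff_zero M x μ, coldiff_one h x μ, coldiff_zero M x ν, coldiff_one h x ν]
  ring

end IsFanoFiveIncMatrix

end Summit.Ventures.DiscreteObjects.PP12
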